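import Literature.Analysis.InnerProduct.HilbertComplexIsomorphismInvariance
import Literature.Analysis.InnerProduct.HilbertComplexFredholmLaplacians
import HarnessLib

/-!
# The Fredholm property of a Hilbert complex — finite cohomology, closed ranges, Fredholm Laplacians — is an
# isomorphism invariant (Brüning–Lesch 1992, Cor 2.19: "`0 ∉ spec_e Δ′` iff the same property holds for `Δ`")

Layer `Literature/Analysis/InnerProduct`, namespace `Literature.Analysis.InnerProduct`; sequel BY NAME of
`HilbertComplexIsomorphismInvariance.lean` (row g34-#6: `nonempty_pmapKer_linearEquiv_of_iso`,
`cohomologyMap_bijective_of_iso`, `quotientRangeMap_bijective_of_iso`, `harmonicMap_bijective_of_iso`),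
`HilbertComplexMaps.lean` (row g34-#3: `map_range_le_of_map`, `exists_cohomologyMap`, `exists_quotientRangeMap`) and
`HilbertComplexFredholmLaplacians.lean` (row g34-#1: `finiteDimensional_cohomology_iff_laplacians_fredholm`, Brüning–Lesch
Thm 2.4 (2) ⟺ (4)). Lane `lit-hodgefound` (Track 2 foundations library), prover seat `lit-hodgefound-p06` (generation 34),
self-proposed row g34-#9. THEOREMS ONLY (no definition, no instance, no named fact). Conventions of rows g34-#3/#6: an
isomorphism of short complexes `(E, F, G; T, S) ≅ (E′, F′, G′; T′, S′)` is a pair of maps of complexes `(g_E, g_F, g_G)`,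
`(k_E, k_F, k_G)` (bounded, `hgT`/`hgS`/`hkT`/`hkS`) with `k ∘ g = id`, `g ∘ k = id` pointwise; the Laplacians `T*T`, `□`,
`SS*` are hypothesis-parametrised (`hdomA`/`hvalA`, `hdom`/`hval`, `hdomC`/`hvalC`).

## Source, verbatim

J. Brüning, M. Lesch, *Hilbert complexes*, J. Funct. Anal. 108 (1992), §2 p. 104 (held text
`paper:doi-10-1016-0022-1236-92-90147-b`, p0017): "COROLLARY 2.19. Let `(𝒟, D)` be a Hilbert complex. Then any
isomorphic Hilbert complex, `(𝒟′, D′)`, has the same analytic and geometric Betti numbers as `(𝒟, D)`. Also,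
`0 ∉ spec_e Δ′` or `spec_e Δ′ = ∅` iff the same property holds for `Δ`." With Thm 2.4 p. 93: "(1) The operator
`D_ev resp. odd` are Fredholm operators … (2) `H^j(𝒟, D)` is finite dimensional for all `j` … (3) `0 ∉ spec_e(Δ)`. (4) The
maps `Δ_j : 𝒟(Δ_j) → H_j` are Fredholm operators" (all equivalent; a *Fredholm complex*).

## What is proved (all over `𝕜 = ℝ` or `ℂ`)

* §1 ranges: **`map_range_eq_range_of_iso`** (`g_F(Im T) = Im T′`), **`isClosed_range_of_iso`** /
  **`isClosed_range_iff_of_iso`** (`Im T` closed ⟺ `Im T′` closed: `Im T′ = k_F⁻¹(Im T)`).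
* §2 finiteness, degree by degree: **`finiteDimensional_pmapKer_of_iso`** (`Ker T`), **`finiteDimensional_cohomology_of_iso`**
  (`Ker S / Im T`), **`finiteDimensional_quotient_range_of_iso`** (`G / Im S`), **`finiteDimensional_harmonic_of_iso`** (`𝔥`,
  a *weak Fredholm complex*), and the package **`fredholmComplex_of_iso`** / **`fredholmComplex_iff_of_iso`**: "(2) finite
  cohomology in all three degrees" is an isomorphism invariant.
* §3 **`laplacians_fredholm_iff_of_iso`**: "(4) `T*T`, `□`, `SS*` have finite-dimensional kernels and closed ranges" for
  `(T, S)` iff for `(T′, S′)` — Cor 2.19's "`0 ∉ spec_e Δ′` iff the same property holds for `Δ`", through row g34-#1.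
NOT in this file: the other clause "`spec_e Δ′ = ∅`" (discreteness); see `HilbertComplexEigenvalueComparison*.lean` (rows
g34-#7/#8), where both complexes are assumed discrete.

## References

* [BruningLesch1992] J. Brüning, M. Lesch, *Hilbert complexes*, J. Funct. Anal. 108 (1992) 88–132, §2 Thm 2.4, Cor 2.5,
  Lemma 2.7, Cor 2.19.
* [ArnoldFalkWinther2010] D. N. Arnold, R. S. Falk, R. Winther, Bull. AMS 47 (2010), §3.1.3 (cochain maps, closed and
  Fredholm Hilbert complexes).
-/

noncomputable section

open scoped InnerProductSpace LinearPMap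

namespace Literature.Analysis.InnerProduct

variable {𝕜 E F G E' F' G' : Type*} [RCLike 𝕜]
variable [NormedAddCommGroup E] [InnerProductSpace 𝕜 E]
variable [NormedAddCommGroup F] [InnerProductSpace 𝕜 F]
variable [NormedAddCommGroup G] [InnerProductSpace 𝕜 G]
variable [NormedAddCommGroup E'] [InnerProductSpace 𝕜 E']
variable [NormedAddCommGroup F'] [InnerProductSpace 𝕜 F']
variable [NormedAddCommGroup G'] [InnerProductSpace 𝕜 G']

variable {T : E →ₗ.[𝕜] F} {S : F →ₗ.[𝕜] G} {T' : E' →ₗ.[𝕜] F'} {S' : F' →ₗ.[𝕜] G'}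
variable {A : E →ₗ.[𝕜] E} {L : F →ₗ.[𝕜] F} {C : G →ₗ.[𝕜] G} {A' : E' →ₗ.[𝕜] E'} {L' : F' →ₗ.[𝕜] F'}
  {C' : G' →ₗ.[𝕜] G'}
variable {g_E : E →L[𝕜] E'} {g_F : F →L[𝕜] F'} {g_G : G →L[𝕜] G'}
  {k_E : E' →L[𝕜] E} {k_F : F' →L[𝕜] F} {k_G : G' →L[𝕜] G}

/-! ### §1 Ranges: `g_F(Im T) = Im T′`, and `Im T` is closed iff `Im T′` is -/

omit [NormedAddCommGroup G] [InnerProductSpace 𝕜 G] [NormedAddCommGroup G'] [InnerProductSpace 𝕜 G'] in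
/-- **`g_F(Im T) = Im T′` for an isomorphism of complexes** (`⊆` for any map of complexes, (2.7b); `⊇`: `T′w′ =
g_F k_F T′w′ = g_F T k_E w′`). [cite: BruningLesch1992, §2 (2.7b), Lemma 2.7 (proof: "`g_i` maps … `im D_{i−1}` to
`im D′_{i−1}`"), Cor 2.19] -/
theorem map_range_eq_range_of_iso
    (hgT : ∀ (w : E) (hw : w ∈ T.domain), ∃ h : g_E w ∈ T'.domain, T' ⟨g_E w, h⟩ = g_F (T ⟨w, hw⟩))
    (hkT : ∀ (w' : E') (hw' : w' ∈ T'.domain), ∃ h : k_E w' ∈ T.domain, T ⟨k_E w', h⟩ = k_F (T' ⟨w', hw'⟩))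
    (hgk_F : ∀ u' : F', g_F (k_F u') = u') :
    (LinearMap.range T.toFun).map (g_F : F →ₗ[𝕜] F') = LinearMap.range T'.toFun := by
  refine le_antisymm (map_range_le_of_map hgT) fun y' hy' ↦ ?_
  exact ⟨k_F y', apply_mem_range_of_map hkT hy', by rw [ContinuousLinearMap.coe_coe, hgk_F]⟩

omit [NormedAddCommGroup G] [InnerProductSpace 𝕜 G] [NormedAddCommGroup G'] [InnerProductSpace 𝕜 G'] in
/-- **Closed range passes along an isomorphism of complexes**: `Im T′ = g_F(Im T) = k_F⁻¹(Im T)` is closed when `Im T`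
is (`k_F` continuous, `g_F ∘ k_F = id`). [cite: BruningLesch1992, §2 Cor 2.19 with Thm 2.4 ((2) includes
closed range via Cor 2.5) and (2.7b)] -/
theorem isClosed_range_of_iso
    (hgT : ∀ (w : E) (hw : w ∈ T.domain), ∃ h : g_E w ∈ T'.domain, T' ⟨g_E w, h⟩ = g_F (T ⟨w, hw⟩))
    (hkT : ∀ (w' : E') (hw' : w' ∈ T'.domain), ∃ h : k_E w' ∈ T.domain, T ⟨k_E w', h⟩ = k_F (T' ⟨w', hw'⟩))
    (hgk_F : ∀ u' : F', g_F (k_F u') = u') (h : IsClosed ((LinearMap.range T.toFun : Submodule 𝕜 F) : Set F)) :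
    IsClosed ((LinearMap.range T'.toFun : Submodule 𝕜 F') : Set F') := by
  have hset : ((LinearMap.range T'.toFun : Submodule 𝕜 F') : Set F') =
      k_F ⁻¹' ((LinearMap.range T.toFun : Submodule 𝕜 F) : Set F) := by
    ext y'
    simp only [SetLike.mem_coe, Set.mem_preimage]
    refine ⟨fun hy' ↦ apply_mem_range_of_map hkT hy', fun hy' ↦ ?_⟩
    rw [← hgk_F y']
    exact apply_mem_range_of_map hgT hy'
  rw [hset]
  exact h.preimage k_F.continuous

omit [NormedAddCommGroup G] [InnerProductSpace 𝕜 G] [NormedAddCommGroup G'] [InnerProductSpace 𝕜 G'] in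
/-- **`Im T` is closed iff `Im T′` is**, for isomorphic complexes. [cite: BruningLesch1992, §2 Cor 2.19, Thm 2.4, Cor 2.5] -/
theorem isClosed_range_iff_of_iso
    (hgT : ∀ (w : E) (hw : w ∈ T.domain), ∃ h : g_E w ∈ T'.domain, T' ⟨g_E w, h⟩ = g_F (T ⟨w, hw⟩))
    (hkT : ∀ (w' : E') (hw' : w' ∈ T'.domain), ∃ h : k_E w' ∈ T.domain, T ⟨k_E w', h⟩ = k_F (T' ⟨w', hw'⟩))
    (hkg_F : ∀ u : F, k_F (g_F u) = u) (hgk_F : ∀ u' : F', g_F (k_F u') = u') :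
    IsClosed ((LinearMap.range T.toFun : Submodule 𝕜 F) : Set F) ↔
      IsClosed ((LinearMap.range T'.toFun : Submodule 𝕜 F') : Set F') :=
  ⟨isClosed_range_of_iso hgT hkT hgk_F, isClosed_range_of_iso hkT hgT hkg_F⟩

/-! ### §2 Finite cohomology, degree by degree, passes along an isomorphism -/

omit [NormedAddCommGroup G] [InnerProductSpace 𝕜 G] [NormedAddCommGroup G'] [InnerProductSpace 𝕜 G'] in
/-- **Degree `0`: `Ker T′` is finite-dimensional when `Ker T` is** (`Ker T ≃ Ker T′`). [cite: BruningLesch1992, §2 Cor 2.19,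
Thm 2.4 (2)] -/
theorem finiteDimensional_pmapKer_of_iso
    (hgT : ∀ (w : E) (hw : w ∈ T.domain), ∃ h : g_E w ∈ T'.domain, T' ⟨g_E w, h⟩ = g_F (T ⟨w, hw⟩))
    (hkT : ∀ (w' : E') (hw' : w' ∈ T'.domain), ∃ h : k_E w' ∈ T.domain, T ⟨k_E w', h⟩ = k_F (T' ⟨w', hw'⟩))
    (hkg_E : ∀ w : E, k_E (g_E w) = w) (hgk_E : ∀ w' : E', g_E (k_E w') = w')
    (h : FiniteDimensional 𝕜 ((LinearMap.ker T.toFun).map T.domain.subtype)) :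
    FiniteDimensional 𝕜 ((LinearMap.ker T'.toFun).map T'.domain.subtype) := by
  obtain ⟨e⟩ := nonempty_pmapKer_linearEquiv_of_iso hgT hkT hkg_E hgk_E
  exact Module.Finite.equiv e

/-- **Degree `1`: `Ker S′ / Im T′` is finite-dimensional when `Ker S / Im T` is** (the induced map is bijective).
[cite: BruningLesch1992, §2 Cor 2.19, Thm 2.4 (2)] -/
theorem finiteDimensional_cohomology_of_iso
    (hgT : ∀ (w : E) (hw : w ∈ T.domain), ∃ h : g_E w ∈ T'.domain, T' ⟨g_E w, h⟩ = g_F (T ⟨w, hw⟩))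
    (hgS : ∀ (u : F) (hu : u ∈ S.domain), ∃ h : g_F u ∈ S'.domain, S' ⟨g_F u, h⟩ = g_G (S ⟨u, hu⟩))
    (hkT : ∀ (w' : E') (hw' : w' ∈ T'.domain), ∃ h : k_E w' ∈ T.domain, T ⟨k_E w', h⟩ = k_F (T' ⟨w', hw'⟩))
    (hkS : ∀ (u' : F') (hu' : u' ∈ S'.domain), ∃ h : k_F u' ∈ S.domain, S ⟨k_F u', h⟩ = k_G (S' ⟨u', hu'⟩))
    (hkg_F : ∀ u : F, k_F (g_F u) = u) (hgk_F : ∀ u' : F', g_F (k_F u') = u')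
    (h : FiniteDimensional 𝕜 (↥((LinearMap.ker S.toFun).map S.domain.subtype) ⧸
      (LinearMap.range T.toFun).comap ((LinearMap.ker S.toFun).map S.domain.subtype).subtype)) :
    FiniteDimensional 𝕜 (↥((LinearMap.ker S'.toFun).map S'.domain.subtype) ⧸
      (LinearMap.range T'.toFun).comap ((LinearMap.ker S'.toFun).map S'.domain.subtype).subtype) := by
  obtain ⟨gq, hg⟩ := exists_cohomologyMap hgT hgS
  obtain ⟨kq, hk⟩ := exists_cohomologyMap hkT hkS
  exact Module.Finite.equiv (LinearEquiv.ofBijective gq (cohomologyMap_bijective_of_iso hgS hkS hkg_F hgk_F hg hk))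

omit [NormedAddCommGroup E] [InnerProductSpace 𝕜 E] [NormedAddCommGroup E'] [InnerProductSpace 𝕜 E'] in
/-- **Degree `2`: `G′ / Im S′` is finite-dimensional when `G / Im S` is.** [cite: BruningLesch1992, §2 Cor 2.19, Thm 2.4 (2)]
-/
theorem finiteDimensional_quotient_range_of_iso
    (hgS : ∀ (u : F) (hu : u ∈ S.domain), ∃ h : g_F u ∈ S'.domain, S' ⟨g_F u, h⟩ = g_G (S ⟨u, hu⟩))
    (hkS : ∀ (u' : F') (hu' : u' ∈ S'.domain), ∃ h : k_F u' ∈ S.domain, S ⟨k_F u', h⟩ = k_G (S' ⟨u', hu'⟩))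
    (hkg_G : ∀ y : G, k_G (g_G y) = y) (hgk_G : ∀ y' : G', g_G (k_G y') = y')
    (h : FiniteDimensional 𝕜 (G ⧸ LinearMap.range S.toFun)) :
    FiniteDimensional 𝕜 (G' ⧸ LinearMap.range S'.toFun) := by
  obtain ⟨gq, hg⟩ := exists_quotientRangeMap hgS
  obtain ⟨kq, hk⟩ := exists_quotientRangeMap hkS
  exact Module.Finite.equiv (LinearEquiv.ofBijective gq (quotientRangeMap_bijective_of_iso hkg_G hgk_G hg hk))

/-- **The harmonic space `𝔥′` is finite-dimensional when `𝔥` is** (`ĝ : 𝔥 → 𝔥′` is bijective; a *weak Fredholm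
complex* stays weak Fredholm). [cite: BruningLesch1992, §2 Lemma 2.7 ("the dimension of `𝓗̂_i` is invariant under complex
isomorphisms"), (2.24), Cor 2.19] -/
theorem finiteDimensional_harmonic_of_iso [CompleteSpace E] [CompleteSpace F] [CompleteSpace E'] [CompleteSpace F']
    (hdT : Dense (T.domain : Set E)) (hcS : S.IsClosed)
    (hST : LinearMap.range T.toFun ≤ (LinearMap.ker S.toFun).map S.domain.subtype)
    (hdT' : Dense (T'.domain : Set E')) (hcS' : S'.IsClosed)
    (hST' : LinearMap.range T'.toFun ≤ (LinearMap.ker S'.toFun).map S'.domain.subtype)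
    (hgT : ∀ (w : E) (hw : w ∈ T.domain), ∃ h : g_E w ∈ T'.domain, T' ⟨g_E w, h⟩ = g_F (T ⟨w, hw⟩))
    (hgS : ∀ (u : F) (hu : u ∈ S.domain), ∃ h : g_F u ∈ S'.domain, S' ⟨g_F u, h⟩ = g_G (S ⟨u, hu⟩))
    (hkT : ∀ (w' : E') (hw' : w' ∈ T'.domain), ∃ h : k_E w' ∈ T.domain, T ⟨k_E w', h⟩ = k_F (T' ⟨w', hw'⟩))
    (hkS : ∀ (u' : F') (hu' : u' ∈ S'.domain), ∃ h : k_F u' ∈ S.domain, S ⟨k_F u', h⟩ = k_G (S' ⟨u', hu'⟩))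
    (hkg_F : ∀ u : F, k_F (g_F u) = u) (hgk_F : ∀ u' : F', g_F (k_F u') = u')
    [((LinearMap.ker S.toFun).map S.domain.subtype ⊓
      (LinearMap.ker T†.toFun).map T†.domain.subtype).HasOrthogonalProjection]
    [((LinearMap.ker S'.toFun).map S'.domain.subtype ⊓
      (LinearMap.ker T'†.toFun).map T'†.domain.subtype).HasOrthogonalProjection]
    (h : FiniteDimensional 𝕜
      ↥((LinearMap.ker S.toFun).map S.domain.subtype ⊓ (LinearMap.ker T†.toFun).map T†.domain.subtype)) :
    FiniteDimensional 𝕜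
      ↥((LinearMap.ker S'.toFun).map S'.domain.subtype ⊓ (LinearMap.ker T'†.toFun).map T'†.domain.subtype) := by
  have hb := harmonicMap_bijective_of_iso hdT hcS hST hdT' hcS' hST' hgT hgS hkT hkS hkg_F hgk_F
  exact Module.Finite.equiv (LinearEquiv.ofBijective
    ((((LinearMap.ker S'.toFun).map S'.domain.subtype ⊓
        (LinearMap.ker T'†.toFun).map T'†.domain.subtype).orthogonalProjectionOnto.comp
      (g_F.comp ((LinearMap.ker S.toFun).map S.domain.subtype ⊓
        (LinearMap.ker T†.toFun).map T†.domain.subtype).subtypeL)).toLinearMap) hb)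

/-- **A Fredholm complex stays Fredholm under isomorphisms** (Thm 2.4 (2): `Ker T`, `Ker S / Im T`, `G / Im S`
finite-dimensional). [cite: BruningLesch1992, §2 Cor 2.19 ("`0 ∉ spec_e Δ′` … iff the same property holds for `Δ`"),
Thm 2.4 (2) ⟺ (3)] -/
theorem fredholmComplex_of_iso
    (hgT : ∀ (w : E) (hw : w ∈ T.domain), ∃ h : g_E w ∈ T'.domain, T' ⟨g_E w, h⟩ = g_F (T ⟨w, hw⟩))
    (hgS : ∀ (u : F) (hu : u ∈ S.domain), ∃ h : g_F u ∈ S'.domain, S' ⟨g_F u, h⟩ = g_G (S ⟨u, hu⟩))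
    (hkT : ∀ (w' : E') (hw' : w' ∈ T'.domain), ∃ h : k_E w' ∈ T.domain, T ⟨k_E w', h⟩ = k_F (T' ⟨w', hw'⟩))
    (hkS : ∀ (u' : F') (hu' : u' ∈ S'.domain), ∃ h : k_F u' ∈ S.domain, S ⟨k_F u', h⟩ = k_G (S' ⟨u', hu'⟩))
    (hkg_E : ∀ w : E, k_E (g_E w) = w) (hgk_E : ∀ w' : E', g_E (k_E w') = w')
    (hkg_F : ∀ u : F, k_F (g_F u) = u) (hgk_F : ∀ u' : F', g_F (k_F u') = u')
    (hkg_G : ∀ y : G, k_G (g_G y) = y) (hgk_G : ∀ y' : G', g_G (k_G y') = y')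
    (h : FiniteDimensional 𝕜 ((LinearMap.ker T.toFun).map T.domain.subtype) ∧
      FiniteDimensional 𝕜 (↥((LinearMap.ker S.toFun).map S.domain.subtype) ⧸
        (LinearMap.range T.toFun).comap ((LinearMap.ker S.toFun).map S.domain.subtype).subtype) ∧
      FiniteDimensional 𝕜 (G ⧸ LinearMap.range S.toFun)) :
    FiniteDimensional 𝕜 ((LinearMap.ker T'.toFun).map T'.domain.subtype) ∧
      FiniteDimensional 𝕜 (↥((LinearMap.ker S'.toFun).map S'.domain.subtype) ⧸
        (LinearMap.range T'.toFun).comap ((LinearMap.ker S'.toFun).map S'.domain.subtype).subtype) ∧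
      FiniteDimensional 𝕜 (G' ⧸ LinearMap.range S'.toFun) :=
  ⟨finiteDimensional_pmapKer_of_iso hgT hkT hkg_E hgk_E h.1,
    finiteDimensional_cohomology_of_iso hgT hgS hkT hkS hkg_F hgk_F h.2.1,
    finiteDimensional_quotient_range_of_iso hgS hkS hkg_G hgk_G h.2.2⟩

/-- **Fredholm complex iff** — isomorphic complexes are Fredholm together. [cite: BruningLesch1992, §2 Cor 2.19, Thm 2.4] -/
theorem fredholmComplex_iff_of_iso
    (hgT : ∀ (w : E) (hw : w ∈ T.domain), ∃ h : g_E w ∈ T'.domain, T' ⟨g_E w, h⟩ = g_F (T ⟨w, hw⟩))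
    (hgS : ∀ (u : F) (hu : u ∈ S.domain), ∃ h : g_F u ∈ S'.domain, S' ⟨g_F u, h⟩ = g_G (S ⟨u, hu⟩))
    (hkT : ∀ (w' : E') (hw' : w' ∈ T'.domain), ∃ h : k_E w' ∈ T.domain, T ⟨k_E w', h⟩ = k_F (T' ⟨w', hw'⟩))
    (hkS : ∀ (u' : F') (hu' : u' ∈ S'.domain), ∃ h : k_F u' ∈ S.domain, S ⟨k_F u', h⟩ = k_G (S' ⟨u', hu'⟩))
    (hkg_E : ∀ w : E, k_E (g_E w) = w) (hgk_E : ∀ w' : E', g_E (k_E w') = w')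
    (hkg_F : ∀ u : F, k_F (g_F u) = u) (hgk_F : ∀ u' : F', g_F (k_F u') = u')
    (hkg_G : ∀ y : G, k_G (g_G y) = y) (hgk_G : ∀ y' : G', g_G (k_G y') = y') :
    (FiniteDimensional 𝕜 ((LinearMap.ker T.toFun).map T.domain.subtype) ∧
      FiniteDimensional 𝕜 (↥((LinearMap.ker S.toFun).map S.domain.subtype) ⧸
        (LinearMap.range T.toFun).comap ((LinearMap.ker S.toFun).map S.domain.subtype).subtype) ∧
      FiniteDimensional 𝕜 (G ⧸ LinearMap.range S.toFun)) ↔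
    (FiniteDimensional 𝕜 ((LinearMap.ker T'.toFun).map T'.domain.subtype) ∧
      FiniteDimensional 𝕜 (↥((LinearMap.ker S'.toFun).map S'.domain.subtype) ⧸
        (LinearMap.range T'.toFun).comap ((LinearMap.ker S'.toFun).map S'.domain.subtype).subtype) ∧
      FiniteDimensional 𝕜 (G' ⧸ LinearMap.range S'.toFun)) :=
  ⟨fredholmComplex_of_iso hgT hgS hkT hkS hkg_E hgk_E hkg_F hgk_F hkg_G hgk_G,
    fredholmComplex_of_iso hkT hkS hgT hgS hgk_E hkg_E hgk_F hkg_F hgk_G hkg_G⟩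

/-! ### §3 Cor 2.19: "`0 ∉ spec_e Δ′` iff the same property holds for `Δ`" — the three Laplacians are Fredholm together -/

/-- **Corollary 2.19 (second clause, Fredholm part): for isomorphic Hilbert complexes, the Laplacians `T*T`, `□ = TT* + S*S`,
`SS*` of one have finite-dimensional kernels and closed ranges iff those of the other do** ("`0 ∉ spec_e Δ′` iff the same
property holds for `Δ`"; through Thm 2.4 (2) ⟺ (4) on both sides, row g34-#1, and §2). [cite: BruningLesch1992, §2 Cor 2.19,
Thm 2.4 (2) ⟺ (3) ⟺ (4), Cor 2.5] -/
theorem laplacians_fredholm_iff_of_iso [CompleteSpace E] [CompleteSpace F] [CompleteSpace G] [CompleteSpace E']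
    [CompleteSpace F'] [CompleteSpace G']
    (hdT : Dense (T.domain : Set E)) (hcT : T.IsClosed) (hdS : Dense (S.domain : Set F)) (hcS : S.IsClosed)
    (hST : LinearMap.range T.toFun ≤ (LinearMap.ker S.toFun).map S.domain.subtype)
    (hdomA : ∀ x : E, x ∈ A.domain ↔ ∃ hx : x ∈ T.domain, T ⟨x, hx⟩ ∈ T†.domain)
    (hvalA : ∀ (x : A.domain) (hx : (x : E) ∈ T.domain) (hTx : T ⟨x, hx⟩ ∈ T†.domain),
      A x = T† ⟨T ⟨x, hx⟩, hTx⟩)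
    (hdom : ∀ x : F, x ∈ L.domain ↔ (∃ hxT : x ∈ T†.domain, T† ⟨x, hxT⟩ ∈ T.domain) ∧
      (∃ hxS : x ∈ S.domain, S ⟨x, hxS⟩ ∈ S†.domain))
    (hval : ∀ (x : L.domain) (hxT : (x : F) ∈ T†.domain) (hTx : T† ⟨x, hxT⟩ ∈ T.domain)
      (hxS : (x : F) ∈ S.domain) (hSx : S ⟨x, hxS⟩ ∈ S†.domain),
      L x = T ⟨T† ⟨x, hxT⟩, hTx⟩ + S† ⟨S ⟨x, hxS⟩, hSx⟩)
    (hdomC : ∀ y : G, y ∈ C.domain ↔ ∃ hy : y ∈ S†.domain, S† ⟨y, hy⟩ ∈ S.domain)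
    (hvalC : ∀ (y : C.domain) (hy : (y : G) ∈ S†.domain) (hSy : S† ⟨y, hy⟩ ∈ S.domain),
      C y = S ⟨S† ⟨y, hy⟩, hSy⟩)
    (hdT' : Dense (T'.domain : Set E')) (hcT' : T'.IsClosed) (hdS' : Dense (S'.domain : Set F')) (hcS' : S'.IsClosed)
    (hST' : LinearMap.range T'.toFun ≤ (LinearMap.ker S'.toFun).map S'.domain.subtype)
    (hdomA' : ∀ x : E', x ∈ A'.domain ↔ ∃ hx : x ∈ T'.domain, T' ⟨x, hx⟩ ∈ T'†.domain)
    (hvalA' : ∀ (x : A'.domain) (hx : (x : E') ∈ T'.domain) (hTx : T' ⟨x, hx⟩ ∈ T'†.domain),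
      A' x = T'† ⟨T' ⟨x, hx⟩, hTx⟩)
    (hdom' : ∀ x : F', x ∈ L'.domain ↔ (∃ hxT : x ∈ T'†.domain, T'† ⟨x, hxT⟩ ∈ T'.domain) ∧
      (∃ hxS : x ∈ S'.domain, S' ⟨x, hxS⟩ ∈ S'†.domain))
    (hval' : ∀ (x : L'.domain) (hxT : (x : F') ∈ T'†.domain) (hTx : T'† ⟨x, hxT⟩ ∈ T'.domain)
      (hxS : (x : F') ∈ S'.domain) (hSx : S' ⟨x, hxS⟩ ∈ S'†.domain),
      L' x = T' ⟨T'† ⟨x, hxT⟩, hTx⟩ + S'† ⟨S' ⟨x, hxS⟩, hSx⟩)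
    (hdomC' : ∀ y : G', y ∈ C'.domain ↔ ∃ hy : y ∈ S'†.domain, S'† ⟨y, hy⟩ ∈ S'.domain)
    (hvalC' : ∀ (y : C'.domain) (hy : (y : G') ∈ S'†.domain) (hSy : S'† ⟨y, hy⟩ ∈ S'.domain),
      C' y = S' ⟨S'† ⟨y, hy⟩, hSy⟩)
    (hgT : ∀ (w : E) (hw : w ∈ T.domain), ∃ h : g_E w ∈ T'.domain, T' ⟨g_E w, h⟩ = g_F (T ⟨w, hw⟩))
    (hgS : ∀ (u : F) (hu : u ∈ S.domain), ∃ h : g_F u ∈ S'.domain, S' ⟨g_F u, h⟩ = g_G (S ⟨u, hu⟩))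
    (hkT : ∀ (w' : E') (hw' : w' ∈ T'.domain), ∃ h : k_E w' ∈ T.domain, T ⟨k_E w', h⟩ = k_F (T' ⟨w', hw'⟩))
    (hkS : ∀ (u' : F') (hu' : u' ∈ S'.domain), ∃ h : k_F u' ∈ S.domain, S ⟨k_F u', h⟩ = k_G (S' ⟨u', hu'⟩))
    (hkg_E : ∀ w : E, k_E (g_E w) = w) (hgk_E : ∀ w' : E', g_E (k_E w') = w')
    (hkg_F : ∀ u : F, k_F (g_F u) = u) (hgk_F : ∀ u' : F', g_F (k_F u') = u')
    (hkg_G : ∀ y : G, k_G (g_G y) = y) (hgk_G : ∀ y' : G', g_G (k_G y') = y') :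
    ((FiniteDimensional 𝕜 ((LinearMap.ker A.toFun).map A.domain.subtype) ∧
        IsClosed ((LinearMap.range A.toFun : Submodule 𝕜 E) : Set E)) ∧
      (FiniteDimensional 𝕜 ((LinearMap.ker L.toFun).map L.domain.subtype) ∧
        IsClosed ((LinearMap.range L.toFun : Submodule 𝕜 F) : Set F)) ∧
      (FiniteDimensional 𝕜 ((LinearMap.ker C.toFun).map C.domain.subtype) ∧
        IsClosed ((LinearMap.range C.toFun : Submodule 𝕜 G) : Set G))) ↔
    ((FiniteDimensional 𝕜 ((LinearMap.ker A'.toFun).map A'.domain.subtype) ∧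
        IsClosed ((LinearMap.range A'.toFun : Submodule 𝕜 E') : Set E')) ∧
      (FiniteDimensional 𝕜 ((LinearMap.ker L'.toFun).map L'.domain.subtype) ∧
        IsClosed ((LinearMap.range L'.toFun : Submodule 𝕜 F') : Set F')) ∧
      (FiniteDimensional 𝕜 ((LinearMap.ker C'.toFun).map C'.domain.subtype) ∧
        IsClosed ((LinearMap.range C'.toFun : Submodule 𝕜 G') : Set G'))) := by
  rw [← finiteDimensional_cohomology_iff_laplacians_fredholm hdT hcT hdS hcS hST hdomA hvalA hdom hval hdomC hvalC,
    ← finiteDimensional_cohomology_iff_laplacians_fredholm hdT' hcT' hdS' hcS' hST' hdomA' hvalA' hdom' hval' hdomC'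
      hvalC']
  exact fredholmComplex_iff_of_iso hgT hgS hkT hkS hkg_E hgk_E hkg_F hgk_F hkg_G hgk_G

end Literature.Analysis.InnerProduct
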